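import Summits.KontsevichZagierPeriods.KontsevichZagierPeriods.Theorems.HurwitzMicroSectorsNormalFormPrincipleLevelOneTriangleSubDimOne
import Literature.NumberTheory.Transcendental.KZProductIdeal
import Literature.NumberTheory.Transcendental.KZDominatedFamilyRelations

/-!
# `NormalFormPrinciple` (stmt-KontsevichZagierPeriods-3869), line `SketchIdeator1` — the leaf
# `stub_boxRigidity` in dimension two, LEVEL `N`: integrating out the triangle (rule 3)

Registered sub-goal `triangle_sub_dimOne_levelN` of the layer "Conjecture 1 for
`[(0,1)², P(x,y)/(1 − (xy)^N)]` off the diagonal" (lead file `…LevelTwo`, wave 3). For `N ≥ 1`,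
`b < a` and `c ∈ ℚ`, the triangle representation `R = [T, g_N]`, `T = {0 < z₀ < 1, 0 ≤ z₁ ≤ z₀}`,
`g_N = c z₀^{a−b−1} z₁^b/(1 − z₁^N)`, and the one-dimensional representation
`N₁ = [(0,1), (c/(a−b)) s^b (Σ_{i<a−b} s^i)/(Σ_{i<N} s^i)]` differ by a relation of the
Kontsevich–Zagier calculus. The chain of moves is the one of the level-one case
(`LevelOne.triangle_sub_dimOne`), with the denominator `1 − w₀` replaced by `1 − w₀^N`:

1. (rule 2) swap the two coordinates (`KZ.of_sub_of_reindex_mem_relations`): the domain becomes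
   `{0 < w₁ < 1, 0 ≤ w₀ ≤ w₁}` and the integrand `h_N = c w₁^{a−b−1} w₀^b/(1 − w₀^N)`;
2. (rule 1) null adjustment: the swapped domain and the closed-fibre band
   `B₂ = {0 < w₀ < 1, w₀ ≤ w₁ ≤ 1}` over the base `(0,1)` both contain the `ℚ`-semialgebraic set
   `W = {0 < w₀ ≤ w₁ < 1}` up to the null segments `{w₀ = 0}`, `{w₁ = 1}`
   (`KZ.IntegralRep.of_sub_of_restrict_mem_relations`, `KZ.of_sub_of_mem_relations_of_eqOn`);
3. (rule 3) ONE Newton–Leibniz move along `w₁ ∈ [w₀, 1]` with the primitive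
   `F = (c/(a−b)) w₁^{a−b} w₀^b/(1 − w₀^N)`, `∂F/∂w₁ = h_N`, and the endpoint identity
   `F(w₀, 1) − F(w₀, w₀) = (c/(a−b)) w₀^b (1 − w₀^{a−b})/(1 − w₀^N)
     = (c/(a−b)) w₀^b (Σ_{i<a−b} w₀^i)/(Σ_{i<N} w₀^i)`,
   since `1 − s^n = (1 − s) Σ_{i<n} s^i` for `n = a − b` and `n = N`, and `1 − s ≠ 0`.

References: M. Kontsevich, D. Zagier, *Periods* (2001), §1.2 rules (1)–(3). No definitions are
introduced.
-/

noncomputable section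

open MeasureTheory Set
open Literature.NumberTheory.Transcendental Literature.NumberTheory.Transcendental.KZ
open Literature.ModelTheory.ExponentialFields (IsSemialgebraic)

namespace Summit.KontsevichZagierPeriods.HurwitzMicroSectors.NormalFormPrinciple.PiBox.LevelN

/-! ### The level-`N` denominator, the primitive along the last coordinate -/

/-- On the unit interval the level-`N` denominator is positive: `0 < 1 − s^N` for `0 ≤ s < 1`,
`N ≥ 1`. [folklore] -/
theorem tsd_den_pos_levelN {N : ℕ} (hN : 1 ≤ N) {s : ℝ} (hs0 : 0 ≤ s) (hs1 : s < 1) :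
    (0:ℝ) < 1 - s ^ N :=
  sub_pos.2 (pow_lt_one₀ hs0 hs1 (Nat.one_le_iff_ne_zero.1 hN))

/-- The derivative of the primitive `s ↦ (c/(a−b)) s^{a−b} x₀^b/(1 − x₀^N)` is the swapped
level-`N` integrand `c s^{a−b−1} x₀^b/(1 − x₀^N)` (`b < a`). [folklore] -/
theorem tsd_hasDerivAt_levelN (N a b : ℕ) (c : ℚ) (hab : b < a) (x : Fin 1 → ℝ) (t : ℝ) :
    HasDerivAt
      (fun s : ℝ => (c : ℝ) / ((a - b : ℕ) : ℝ) * (s ^ (a - b) * x 0 ^ b) / (1 - x 0 ^ N))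
      ((c : ℝ) * (t ^ (a - b - 1) * x 0 ^ b) / (1 - x 0 ^ N)) t := by
  have hne : ((a - b : ℕ) : ℝ) ≠ 0 := Nat.cast_ne_zero.2 (Nat.sub_ne_zero_of_lt hab)
  have h := (((hasDerivAt_pow (a - b) t).mul_const (x 0 ^ b)).const_mul
    ((c : ℝ) / ((a - b : ℕ) : ℝ))).div_const (1 - x 0 ^ N)
  refine h.congr_deriv ?_
  rw [mul_assoc (((a - b : ℕ) : ℝ)), ← mul_assoc, div_mul_cancel₀ _ hne]

/-- The endpoint identity of the level-`N` Newton–Leibniz move: for `0 ≤ s < 1` and `N ≥ 1`,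
`(c/(a−b)) s^b (Σ_{i<a−b} s^i)/(Σ_{i<N} s^i) = F(s, 1) − F(s, s)` with
`F(w₀, w₁) = (c/(a−b)) w₁^{a−b} w₀^b/(1 − w₀^N)`, because `(Σ_{i<n} s^i)(1 − s) = 1 − s^n` for
`n = a − b` and `n = N` (finite geometric sums) and `1 − s ≠ 0`, `1 − s^N ≠ 0`. [folklore] -/
theorem tsd_endpoint_levelN {N : ℕ} (hN : 1 ≤ N) (a b : ℕ) (c : ℚ) {s : ℝ} (hs0 : 0 ≤ s)
    (hs1 : s < 1) :
    (c : ℝ) / ((a - b : ℕ) : ℝ) * (s ^ b * ∑ i ∈ Finset.range (a - b), s ^ i) /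
        (∑ i ∈ Finset.range N, s ^ i) =
      (c : ℝ) / ((a - b : ℕ) : ℝ) * ((1:ℝ) ^ (a - b) * s ^ b) / (1 - s ^ N) -
        (c : ℝ) / ((a - b : ℕ) : ℝ) * (s ^ (a - b) * s ^ b) / (1 - s ^ N) := by
  have hne : (1 - s) ≠ 0 := (sub_pos.2 hs1).ne'
  have hneN : (1 - s ^ N) ≠ 0 := (tsd_den_pos_levelN hN hs0 hs1).ne'
  have hS : ∑ i ∈ Finset.range (a - b), s ^ i = (1 - s ^ (a - b)) / (1 - s) := by
    rw [eq_div_iff hne]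
    exact geom_sum_mul_neg s (a - b)
  have hT : ∑ i ∈ Finset.range N, s ^ i = (1 - s ^ N) / (1 - s) := by
    rw [eq_div_iff hne]
    exact geom_sum_mul_neg s N
  rw [hS, hT, one_pow]
  field_simp

/-! ### The stub -/

/-- **V4 (integrating out the triangle at level `N`; registered sub-goal of the level-`N` layer of
`stub_boxRigidity` in dimension two).** For `N ≥ 1`, `b < a` and `c ∈ ℚ`, the triangle
representation `R = [T, c z₀^{a−b−1} z₁^b/(1 − z₁^N)]`, `T = {0 < z₀ < 1, 0 ≤ z₁ ≤ z₀}`, and the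
one-dimensional representation `N₁ = [(0,1), (c/(a−b)) s^b (Σ_{i<a−b} s^i)/(Σ_{i<N} s^i)]` differ
by a relation: swap the coordinates (rule 2), adjust the two null segments `{w₀ = 0}`, `{w₁ = 1}`
(rule 1), and make ONE Newton–Leibniz move along `w₁ ∈ [w₀, 1]` over the base `(0,1)` with the
primitive `(c/(a−b)) w₁^{a−b} w₀^b/(1 − w₀^N)` (rule 3), whose endpoint difference is the quotient
of the two finite geometric sums. [cite: KontsevichZagier2001, §1.2 rules (1)–(3)] -/
theorem triangle_sub_dimOne_levelN (N : ℕ) (hN : 1 ≤ N) (a b : ℕ) (c : ℚ) (hab : b < a)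
    (R : IntegralRep 2) (N₁ : IntegralRep 1)
    (hRd : R.domain =
      KZlog.band {y : Fin 1 → ℝ | 0 < y 0 ∧ y 0 < 1} (fun _ => (0:ℝ)) (fun y => y 0))
    (hRi : EqOn R.integrand
      (fun z => (c : ℝ) * (z 0 ^ (a - b - 1) * z 1 ^ b) / (1 - z 1 ^ N)) R.domain)
    (hN₁d : N₁.domain = {x | ∀ i, x i ∈ Set.Ioo (0:ℝ) 1})
    (hN₁i : EqOn N₁.integrand (fun x => (c : ℝ) / ((a - b : ℕ) : ℝ) *
      (x 0 ^ b * ∑ i ∈ Finset.range (a - b), x 0 ^ i) / (∑ i ∈ Finset.range N, x 0 ^ i))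
      N₁.domain) :
    of R - of N₁ ∈ relations := by
  -- the base `τ = N₁.domain = (0,1) ⊆ ℝ¹`
  have hτ : IsSemialgebraic ℚ N₁.domain := N₁.isSemialgebraic_domain
  have hmemτ : ∀ x : Fin 1 → ℝ, x ∈ N₁.domain ↔ 0 < x 0 ∧ x 0 < 1 := fun x => by
    rw [hN₁d]
    exact Fin.forall_fin_one
  -- membership in the triangle, the swapped triangle and the upper band
  have hmemR : ∀ z : Fin 2 → ℝ, z ∈ R.domain ↔ (0 < z 0 ∧ z 0 < 1) ∧ 0 ≤ z 1 ∧ z 1 ≤ z 0 :=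
    fun z => by
    rw [hRd]
    exact Iff.rfl
  have hmemR' : ∀ w : Fin 2 → ℝ, w ∈ (R.reindex (Equiv.swap (0 : Fin 2) 1)).domain ↔
      (0 < w 1 ∧ w 1 < 1) ∧ 0 ≤ w 0 ∧ w 0 ≤ w 1 := fun w => by
    rw [IntegralRep.reindex_domain, mem_setOf_eq, hmemR]
    simp only [Equiv.swap_apply_left, Equiv.swap_apply_right]
  have hmemB : ∀ w : Fin 2 → ℝ, w ∈ KZlog.band N₁.domain (fun y => y 0) (fun _ => (1:ℝ)) ↔
      (0 < w 0 ∧ w 0 < 1) ∧ w 0 ≤ w 1 ∧ w 1 ≤ 1 := fun w => LevelOne.tsd_mem_upperBand hN₁d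
  -- the common `ℚ`-semialgebraic set `W = {0 < w₀ ≤ w₁ < 1}`
  have hW : IsSemialgebraic ℚ {w : Fin 2 → ℝ | 0 < w 0 ∧ w 0 ≤ w 1 ∧ w 1 < 1} :=
    LevelOne.tsd_isSemialgebraic_W
  have hWm : MeasurableSet {w : Fin 2 → ℝ | 0 < w 0 ∧ w 0 ≤ w 1 ∧ w 1 < 1} :=
    Literature.ModelTheory.ExponentialFields.IsSemialgebraic.measurableSet_holds hW
  have hWR' : {w : Fin 2 → ℝ | 0 < w 0 ∧ w 0 ≤ w 1 ∧ w 1 < 1} ⊆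
      (R.reindex (Equiv.swap (0 : Fin 2) 1)).domain := fun w hw =>
    (hmemR' w).2 ⟨⟨hw.1.trans_le hw.2.1, hw.2.2⟩, hw.1.le, hw.2.1⟩
  have hWB : {w : Fin 2 → ℝ | 0 < w 0 ∧ w 0 ≤ w 1 ∧ w 1 < 1} ⊆
      KZlog.band N₁.domain (fun y => y 0) (fun _ => (1:ℝ)) := fun w hw =>
    (hmemB w).2 ⟨⟨hw.1, hw.2.1.trans_lt hw.2.2⟩, hw.2.1, hw.2.2.le⟩
  have hvolR' : volume ((R.reindex (Equiv.swap (0 : Fin 2) 1)).domain \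
      {w : Fin 2 → ℝ | 0 < w 0 ∧ w 0 ≤ w 1 ∧ w 1 < 1}) = 0 := by
    refine measure_mono_null (fun w hw => ?_)
      (Measure.pi_hyperplane (fun _ => (volume : Measure ℝ)) 0 0)
    have h := (hmemR' w).1 hw.1
    show w 0 = 0
    by_contra h0
    exact hw.2 ⟨lt_of_le_of_ne h.2.1 (Ne.symm h0), h.2.2, h.1.2⟩
  have hvolB : volume (KZlog.band N₁.domain (fun y => y 0) (fun _ => (1:ℝ)) \
      {w : Fin 2 → ℝ | 0 < w 0 ∧ w 0 ≤ w 1 ∧ w 1 < 1}) = 0 := by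
    refine measure_mono_null (fun w hw => ?_)
      (Measure.pi_hyperplane (fun _ => (volume : Measure ℝ)) 1 1)
    have h := (hmemB w).1 hw.1
    show w 1 = 1
    by_contra h1
    exact hw.2 ⟨h.1.1, h.2.1, lt_of_le_of_ne h.2.2 h1⟩
  -- the swapped integrand `h_N` on `W`, read off `R` through the swap
  have hRW : ∀ w ∈ {w : Fin 2 → ℝ | 0 < w 0 ∧ w 0 ≤ w 1 ∧ w 1 < 1},
      (R.reindex (Equiv.swap (0 : Fin 2) 1)).integrand w =
        (c : ℝ) * (w 1 ^ (a - b - 1) * w 0 ^ b) / (1 - w 0 ^ N) := fun w hw => by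
    have hw' : (fun i => w (Equiv.swap (0 : Fin 2) 1 i)) ∈ R.domain := hWR' hw
    rw [IntegralRep.reindex_integrand]
    show R.integrand (fun i => w (Equiv.swap (0 : Fin 2) 1 i)) = _
    rw [hRi hw']
    simp only [Equiv.swap_apply_left, Equiv.swap_apply_right]
  -- the upper-band representation `r₂ = [B₂, h_N]`
  have hB₂ : IsSemialgebraic ℚ (KZlog.band N₁.domain (fun y => y 0) (fun _ => (1:ℝ))) :=
    KZlog.isSemialgebraic_band (isSemialgebraicFunOn_apply hτ 0)
      (by simpa using isSemialgebraicFunOn_ratCast hτ 1)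
  have hden : ∀ w ∈ KZlog.band N₁.domain (fun y => y 0) (fun _ => (1:ℝ)),
      (0:ℝ) < 1 - w 0 ^ N := fun w hw =>
    tsd_den_pos_levelN hN ((hmemB w).1 hw).1.1.le ((hmemB w).1 hw).1.2
  have hh : IsSemialgebraicFunOn ℚ (KZlog.band N₁.domain (fun y => y 0) (fun _ => (1:ℝ)))
      (fun w => (c : ℝ) * (w 1 ^ (a - b - 1) * w 0 ^ b) / (1 - w 0 ^ N)) := by
    refine (isSemialgebraicFunOn_aeval_div_aeval hB₂
      (MvPolynomial.C c * (MvPolynomial.X 1 ^ (a - b - 1) * MvPolynomial.X 0 ^ b))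
      (1 - MvPolynomial.X 0 ^ N) fun w hw => ?_).congr fun w _ => by simp
    simp only [map_sub, map_one, map_pow, MvPolynomial.aeval_X]
    exact (hden w hw).ne'
  have hintW : IntegrableOn
      (fun w : Fin 2 → ℝ => (c : ℝ) * (w 1 ^ (a - b - 1) * w 0 ^ b) / (1 - w 0 ^ N))
      {w : Fin 2 → ℝ | 0 < w 0 ∧ w 0 ≤ w 1 ∧ w 1 < 1} :=
    ((R.reindex (Equiv.swap (0 : Fin 2) 1)).integrableOn.mono_set hWR').congr_fun hRW hWm
  have hsubB : KZlog.band N₁.domain (fun y => y 0) (fun _ => (1:ℝ)) ⊆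
      {w : Fin 2 → ℝ | 0 < w 0 ∧ w 0 ≤ w 1 ∧ w 1 < 1} ∪ {w | w 1 = 1} := by
    intro w hw
    have h := (hmemB w).1 hw
    rcases h.2.2.lt_or_eq with h1 | h1
    · exact Or.inl ⟨h.1.1, h.2.1, h1⟩
    · exact Or.inr h1
  have hint : IntegrableOn
      (fun w : Fin 2 → ℝ => (c : ℝ) * (w 1 ^ (a - b - 1) * w 0 ^ b) / (1 - w 0 ^ N))
      (KZlog.band N₁.domain (fun y => y 0) (fun _ => (1:ℝ))) :=
    (hintW.union (IntegrableOn.of_measure_zero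
      (Measure.pi_hyperplane (fun _ => (volume : Measure ℝ)) 1 1))).mono_set hsubB
  obtain ⟨r₂, hr₂d, hr₂i⟩ : ∃ r₂ : IntegralRep 2,
      r₂.domain = KZlog.band N₁.domain (fun y => y 0) (fun _ => (1:ℝ)) ∧
      r₂.integrand = fun w => (c : ℝ) * (w 1 ^ (a - b - 1) * w 0 ^ b) / (1 - w 0 ^ N) :=
    ⟨⟨_, _, hB₂, hh, hint⟩, rfl, rfl⟩
  have hWr₂ : {w : Fin 2 → ℝ | 0 < w 0 ∧ w 0 ≤ w 1 ∧ w 1 < 1} ⊆ r₂.domain := by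
    rw [hr₂d]
    exact hWB
  have hvolr₂ : volume (r₂.domain \ {w : Fin 2 → ℝ | 0 < w 0 ∧ w 0 ≤ w 1 ∧ w 1 < 1}) = 0 := by
    rw [hr₂d]
    exact hvolB
  -- (1) rule 2: the swap
  have hS := of_sub_of_reindex_mem_relations R (Equiv.swap (0 : Fin 2) 1)
  -- (2) rule 1: the two null adjustments and the congruence on `W`
  have hres₁ := IntegralRep.of_sub_of_restrict_mem_relations
    (R.reindex (Equiv.swap (0 : Fin 2) 1)) hW hWR' hvolR'
  have hres₂ := IntegralRep.of_sub_of_restrict_mem_relations r₂ hW hWr₂ hvolr₂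
  have hcmp : of ((R.reindex (Equiv.swap (0 : Fin 2) 1)).restrict _ hW hWR') -
      of (r₂.restrict _ hW hWr₂) ∈ relations := by
    refine of_sub_of_mem_relations_of_eqOn rfl fun w hw => ?_
    show (R.reindex (Equiv.swap (0 : Fin 2) 1)).integrand w = r₂.integrand w
    rw [hRW w hw, hr₂i]
  -- (3) rule 3: ONE Newton–Leibniz move along `w₁ ∈ [w₀, 1]` over `τ`
  have hs0 : ∀ (x : Fin 1 → ℝ) (t : ℝ), (Fin.snoc x t : Fin 2 → ℝ) 0 = x 0 := fun _ _ => rfl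
  have hs1 : ∀ (x : Fin 1 → ℝ) (t : ℝ), (Fin.snoc x t : Fin 2 → ℝ) 1 = t := fun _ _ => rfl
  have hNL : of r₂ - of N₁ ∈ relations := by
    refine newtonLeibnizRel_subset_relations ⟨1, r₂, N₁, fun y => y 0, fun _ => (1:ℝ),
      fun w => (c : ℝ) / ((a - b : ℕ) : ℝ) * (w 1 ^ (a - b) * w 0 ^ b) / (1 - w 0 ^ N),
      ?_, isSemialgebraicFunOn_apply hτ 0, (by simpa using isSemialgebraicFunOn_ratCast hτ 1),
      fun x hx => ((hmemτ x).1 hx).2.le, ?_, ?_, ?_, ?_, rfl⟩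
    · -- the primitive is a quotient of `ℚ`-polynomials on the band
      rw [hr₂d]
      refine (isSemialgebraicFunOn_aeval_div_aeval hB₂
        (MvPolynomial.C (c / ((a - b : ℕ) : ℚ)) *
          (MvPolynomial.X 1 ^ (a - b) * MvPolynomial.X 0 ^ b))
        (1 - MvPolynomial.X 0 ^ N) fun w hw => ?_).congr fun w _ => by simp
      simp only [map_sub, map_one, map_pow, MvPolynomial.aeval_X]
      exact (hden w hw).ne'
    · -- the band over `τ` with edges `w₀ ≤ w₁ ≤ 1`
      rw [hr₂d]
      rfl
    · -- continuity of the primitive on the closed fibre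
      intro x _
      simp only [hs0, hs1]
      exact (by fun_prop : Continuous fun t : ℝ =>
        (c : ℝ) / ((a - b : ℕ) : ℝ) * (t ^ (a - b) * x 0 ^ b) / (1 - x 0 ^ N)).continuousOn
    · -- its derivative on the open fibre is the integrand
      intro x _ t _
      rw [hr₂i]
      simp only [hs0, hs1]
      exact tsd_hasDerivAt_levelN N a b c hab x t
    · -- the endpoint difference is the quotient of the two finite geometric sums
      intro x hx
      rw [hN₁i hx]
      simp only [hs0, hs1]
      exact tsd_endpoint_levelN hN a b c ((hmemτ x).1 hx).1.le ((hmemτ x).1 hx).2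
  -- (4) bookkeeping
  have key : of R - of N₁ = (of R - of (R.reindex (Equiv.swap (0 : Fin 2) 1))) +
      (of (R.reindex (Equiv.swap (0 : Fin 2) 1)) -
        of ((R.reindex (Equiv.swap (0 : Fin 2) 1)).restrict _ hW hWR')) +
      (of ((R.reindex (Equiv.swap (0 : Fin 2) 1)).restrict _ hW hWR') -
        of (r₂.restrict _ hW hWr₂)) -
      (of r₂ - of (r₂.restrict _ hW hWr₂)) + (of r₂ - of N₁) := by
    abel
  rw [key]
  exact relations.add_mem (relations.sub_mem (relations.add_mem (relations.add_mem hS hres₁) hcmp)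
    hres₂) hNL

end Summit.KontsevichZagierPeriods.HurwitzMicroSectors.NormalFormPrinciple.PiBox.LevelN
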